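import Summits.Ventures.HodgeRepro.MuTableSignsDense
import Summits.Ventures.HodgeRepro.CongruenceHermitianLE

/-!
# Route C's form carries R5: the R0 object and Lemma W's every clause in ONE theorem (seat p5)

Blind re-derivation cell `pub-hodge-repro`, seat `p5`.  p2's `MuTableSigns.exists_hermitian_dense_ratPointsOf`
constructs, for every CM field `K`, every `p` and every distinguished embedding `φ₀`, the Route C object of
ROUTE-C R0: a Hermitian form `HK` of signature `(p,1)` at `φ₀` (Sylvester matrix `P`), positive definite at every
other infinite place.  p5's `lemmaW_all_congruenceCover_ratPointsOf_le` proves R5 with every clause on the rational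
points of ANY such form.  Composed here: for every `K`, `p`, `φ₀` there is a Route C form on whose rational points
R5 holds for `g′ ≤ p` forms — rational translates `γ_1, …, γ_g` with (i) a submersion on an open dense set,
(ii) dominance (every entire `H : ℂ^g → ℂ` vanishing on the image of the ball is `0`), (iii) per-translate
`Γ″`-invariance, (iv) the congruence level `toUp(Γ(L)) ≤ Γ″`, `L ≠ 0`, (v) `[Γ′ : Γ″] < ∞` — for every congruence
`Γ′` between `Γ(M)` and `U(H_K)(𝓞_K)` and every family of `Γ′`-invariant exact covector fields `dh_l`.

What stays on paper: ROUTE-C 13.2(a) (the `dh_l` are the lifts of the pulled-back eigenforms; `T`-equivariance),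
13.2(c) (components), and the textbook sentence that a proper closed subvariety of the projective `A′` lies in a
divisor (zero locus of a theta function).

Nothing here says anything about the status of the Hodge conjecture for CM abelian varieties.
-/

set_option autoImplicit false

noncomputable section

namespace Summit.Ventures.HodgeRepro

namespace CongHerm

open Matrix Filter Topology
open NumberField
open scoped ComplexOrder
open HodgeRepro.BallGen (Idx GLp U Ball unitaryGroupOf ratPointsOf pullback J)
open HodgeRepro.BallGen.Inv (IsInvariant)
open HodgeRepro.BallGen.Holo (ballSet actE)
open HodgeRepro.BallGen.Subm (dcov)
open CongGen

variable {K : Type} [Field K] [NumberField K] [IsCMField K]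

/-- **Route C's form carries R5 (every clause, `g′ ≤ p`).**  For every CM field `K`, every `p` and every embedding
`φ₀ : K → ℂ` there are a Hermitian `HK ∈ M_{p+1}(K)` and a Sylvester matrix `P` at `φ₀` (`Pᴴ (φ₀ HK) P = J p`,
signature `(p,1)`) with `HK` positive definite at every other infinite place, such that for every `g ≤ p`, every
congruence subgroup `Γ(M) ≤ Γ′ ≤ U(H_K)(𝓞_K)` (`M ≠ 0`) transported to `U(p,1)`, and every family of `g`
functions `h_l` analytic near the ball, none locally constant on it, with `Γ′`-invariant `dh_l`, there are
rational `γ_1, …, γ_g ∈ ratPointsOf` with: a submersion `w ↦ (h_l(γ_l w))_{l<g}` on an open dense set; every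
entire `H : ℂ^g → ℂ` vanishing on the image of the ball is `0`; each translate `γ_l^*(dh_l)` is
`Γ″ = Γ′ ⊓ ⨅_l γ_l⁻¹Γ′γ_l`-invariant; `toUp(Γ(L)) ≤ Γ″` for some `L ≠ 0`; and `Γ″` has finite index in `Γ′`. -/
theorem exists_routeC_form_lemmaW_all_le (p : ℕ) (φ₀ : K →+* ℂ) :
    ∃ (HK : Matrix (Idx p) (Idx p) K) (P : GLp p)
      (hP : (P : Matrix (Idx p) (Idx p) ℂ)ᴴ * HK.map φ₀ * (P : Matrix (Idx p) (Idx p) ℂ) = J p),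
      HKᴴ = HK ∧ (∀ φ : K →+* ℂ, InfinitePlace.mk φ ≠ InfinitePlace.mk φ₀ → (HK.map φ).PosDef) ∧
      ∀ {g : ℕ}, g ≤ p → ∀ {Γ' : Subgroup (unitaryGroupOf HK)}, Γ' ≤ arithU HK → ∀ {M : 𝓞 K}, M ≠ 0 →
        congrU HK M ≤ Γ' → ∀ {h : Fin g → (Fin p → ℂ) → ℂ}, (∀ l, AnalyticOnNhd ℂ (h l) (ballSet p)) →
        (∀ l, ∃ w : Ball p, dcov (h l) w.1 ≠ 0) →
        (∀ l, IsInvariant (Γ'.map (toUp HK φ₀ P hP)) fun w : Ball p => dcov (h l) w.1) →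
        ∃ γ : Fin g → U p, (∀ l, γ l ∈ ratPointsOf φ₀ HK P hP) ∧
          (∃ S : Set (Ball p), IsOpen S ∧ Dense S ∧ ∀ z ∈ S, ∀ U ∈ 𝓝 z.1,
            (fun w l => h l (actE (γ l) w)) '' U ∈ 𝓝 fun l => h l (actE (γ l) z.1)) ∧
          (∀ H : (Fin g → ℂ) → ℂ, AnalyticOnNhd ℂ H Set.univ →
            (∀ w ∈ ballSet p, H (fun l => h l (actE (γ l) w)) = 0) → H = 0) ∧
          (∀ l, IsInvariant (Γ'.map (toUp HK φ₀ P hP) ⊓ ⨅ l, conjSubG (γ l) (Γ'.map (toUp HK φ₀ P hP)))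
            (pullback (γ l) fun w : Ball p => dcov (h l) w.1)) ∧
          (∃ L : 𝓞 K, L ≠ 0 ∧ (congrU HK L).map (toUp HK φ₀ P hP) ≤
            Γ'.map (toUp HK φ₀ P hP) ⊓ ⨅ l, conjSubG (γ l) (Γ'.map (toUp HK φ₀ P hP))) ∧
          (Γ'.map (toUp HK φ₀ P hP) ⊓ ⨅ l, conjSubG (γ l) (Γ'.map (toUp HK φ₀ P hP))).IsFiniteRelIndex
            (Γ'.map (toUp HK φ₀ P hP)) := by
  obtain ⟨HK, P, hP, hH, hpos, _⟩ := MuTableSigns.exists_hermitian_dense_ratPointsOf (K := K) p φ₀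
  refine ⟨HK, P, hP, hH, hpos, ?_⟩
  intro g hg Γ' hΓ M hM0 hM h hh hh0 hhΓ
  exact lemmaW_all_congruenceCover_ratPointsOf_le HK φ₀ P hP hg hΓ hM0 hM hh hh0 hhΓ

end CongHerm

end Summit.Ventures.HodgeRepro

end
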